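import Literature.MathematicalPhysics.QuantumFieldTheory.Balaban1983to89.B10Eq17RecursiveSystem

/-!
# `Balaban1983to89.B10Eq19ThirdOrder` — T. Bałaban, *Ultraviolet stability of three-dimensional lattice pure gauge
field theories*, Commun. Math. Phys. **102** (1985) 255–275 [Balaban1985UV3], display (19) p. 261, SECOND MEMBER:
«A(exp i(A − D̃(A))U₁) = A(U₁) − ⟨D̃(A), J⟩ + ½⟨A − D̃(A), Δ(U₁)(A − D̃(A))⟩ + V₀(A − D̃(A))
 = A(U₁) − ⟨D̃⁽²⁾(A), J⟩ + ½⟨A, Δ(U₁)A⟩ + Ṽ₀(A), (19)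
where Ṽ₀(A) is defined by the last equality. It is an analytic function of A with an expansion beginning with third
order terms» — the regrouping and the two adjectives of `Ṽ₀` («analytic», «beginning with third order terms»)
PROVED for the local solution of (17) (theorems only; every scalar field `𝕜`)

statement-level skeleton of published theorems with citation tags; proofs where landed; nothing here is a claim about
the Yang–Mills mass gap

PDF held: `paper:balaban1985-cmp102-uv-stability-3d` (journal page = PDF page + 254); p. 261 = `p0007.txt` (the text
layer keeps only «… + ṼQ(A), (19) where ṼQ(A) is defined by the last equality. It is an analytic function of A with an
expansion beginning with third order terms, and it is a sum over plaquette variables of functions which are almost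
local in A and U₁»; the display is read on the render
`run/shared/lean/pub/pub-balaban/b2b-balaban-ref1/pages/1985-cmp102-uv-stability-3d/…-p007-x2.png`, transcription of
record `lit-balaban-r07/ROWS-B10.md` §2 display B10.Eq19).

CITATION HEADER.  WHAT IS REPRODUCED: the proof-narrative display `B10.Eq19` of SKELETON block B10 (not a row of
record; `run/shared/lean/pub/lit-balaban/lit-balaban-r07/ROWS-B10.md` §2) — its SECOND member and the sentence after
it.  Unit `lit-balaban-r07` (fold owner of B10), gen 20.  What the tree had: `B10Eq19LinearTerm` (r07 gens 14–16)
proves the sentence BEFORE (19) («a linear term in its expansion vanishes») and the FIRST-member shape of (19) with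
the remainder split at first order only (`expansion19_b11`: `… − ⟨D̃(A), J⟩ + q(A)`, `q′(0) = 0`); the passage to
the second member — replacing `D̃` by its quadratic term `D̃⁽²⁾` in the `J`-pairing and `A − D̃(A)` by `A` in the
quadratic form, at the price of a remainder `Ṽ₀` of THIRD order — was not formalised.  It is formalised here from
the two facts print uses: `D̃` is analytic with «a Taylor expansion beginning with second order terms» ((17) p. 260;
`B10Eq17LocalSolution.Eq17Local`), and `V₀` begins with third-order terms ([7] (26) p. 282: «V₀ … of third and
higher order»).

DICTIONARY.  `E` = the space of bond fields `A` (print: g-valued fields on the bonds of Ω₁; in §2 `E = β → X` as in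
`B10Eq17LocalSolution`); `φ : E →L[𝕜] 𝕜` = the pairing `⟨·, J⟩`, `J = D*_{U₁}Im U₁`; `Δ : E →L[𝕜] E →L[𝕜] 𝕜` = the
bounded bilinear form `⟨·, Δ(U₁)·⟩`; `V₀ : E → 𝕜` = the third-and-higher-order functional of [7] (26); `Dt : E → E` =
the bond field `A ↦ D̃(A)` (in §2: `A ↦ hD̃(A) = H (Dt A)` with the support operator `H` of p. 260); `D2 : E → E` =
print's quadratic term `D̃⁽²⁾` (in §2: `A ↦ H (p 2 (A, A))` for an expansion `p` of the local solution); `a0` =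
`A(U₁)`.  Print's `Ṽ₀` — «defined by the last equality» — is WRITTEN OUT wherever it occurs (no definition is
introduced):
  `Ṽ₀(A) = −φ(Dt A − D2 A) + 2⁻¹·(Δ (A − Dt A) (A − Dt A) − Δ A A) + V₀(A − Dt A)`.
«Beginning with third order terms» is typed as `Ṽ₀ =O[𝓝 0] (‖A‖³)`; «analytic» as `AnalyticAt 𝕜 Ṽ₀ 0`.

WHAT THIS FILE PROVES (theorems only; no `def`, no named `Prop` fact; kernel, 0 sorry, standard axioms).
* §1 generic (any `𝕜`, normed `E`): `member_two` (the regrouping identity: first member of (19) = second member with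
  the written-out `Ṽ₀`, by linearity of `φ` alone); **`remainder_isBigO`** (`Dt = O(‖A‖²)`, `Dt − D2 = O(‖A‖³)`,
  `V₀ = O(‖Y‖³)` ⇒ `Ṽ₀ = O(‖A‖³)`); **`remainder_analyticAt`** (`Dt`, `D2` analytic at `0`, `Dt 0 = 0`, `V₀`
  analytic at `0` ⇒ `Ṽ₀` analytic at `0`); the inputs from an expansion `p` of `Dt` at `0` with `p₀ = p₁ = 0`:
  `isBigO_sq_of_series` (`Dt = O(‖A‖²)`), `isBigO_sub_coeff_two` (`Dt − p₂(A, A) = O(‖A‖³)`),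
  `analyticAt_coeff_two_diag`; packaged: `member_two_third_order`.
* §2 in the letters of (17) for the LOCAL SOLUTION `Dt` of `Eq17Local 𝕜 b₀ h C̃ r δ Dt` with the bounded support
  operator `H` (`H D = hOpLin b₀ h D`), bond field `A ↦ H (Dt A)` and quadratic term `D̃⁽²⁾(A) = H (p 2 (A, A))`:
  `eq17Local_bond_series` (the bond field has the expansion `H ∘ p`, orders `0`, `1` vanish),
  `eq17Local_bond_isBigO_sq`, `eq17Local_bond_sub_coeff_two_isBigO`, **`eq17Local_tildeV0_isBigO`**,
  **`eq17Local_tildeV0_analyticAt`**, **`eq17Local_eq19_member_two`** (the second member of (19) with both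
  adjectives of `Ṽ₀`, for EVERY expansion `p` of `Dt` at `0`); with print's identification `QD̃⁽²⁾ = C⁽²⁾` of
  p. 260 (`B10Eq17RecursiveSystem.eq17Local_coeff_two_diag`, imported): `eq17Local_Jterm_eq_hC2`
  (`⟨hD̃⁽²⁾(A), J⟩ = ⟨hC⁽²⁾(A), J⟩`) and `eq17Local_eq19_member_two_hC2` (the second member with `hC⁽²⁾`).

HONEST SCOPE.  (i) The FIRST member of (19) is taken as GIVEN (hypothesis `h19 : f A = a0 − φ(Dt A) + …` on the
constraint set or everywhere) — it is (26) of [7] with the linear term `⟨A, J⟩` dropped on the constraint surface,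
proved on the B11 carrier in `B11Eq26FirstVariation` and knitted in `B10Eq19LinearTerm`; nothing of it is re-derived.
(ii) «a sum over plaquette variables of functions which are almost local in A and U₁» (the locality structure of
`Ṽ₀`) is NOT formalised.  (iii) The identification `D̃⁽²⁾ = hC⁽²⁾` (p. 260) is `B10Eq17RecursiveSystem` (imported, used by name in the last
two theorems); elsewhere `D2` is the quadratic Taylor term of the bond field itself.  NOT summit progress.
-/

open Metric Set Filter Topology Asymptotics
open scoped ContDiff

namespace Literature.MathematicalPhysics.QuantumFieldTheory.Balaban1983to89.B10Eq19ThirdOrder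

open B13PkLocalTerms B10Eq17LocalSolution B12SecondOrder267 B10Eq17RecursiveSystem

/-! ## §1  The regrouping (19)₁ = (19)₂ and the two adjectives of `Ṽ₀`, generically -/

section Generic

variable {𝕜 : Type*} [NontriviallyNormedField 𝕜] {E : Type*} [NormedAddCommGroup E] [NormedSpace 𝕜 E]
  {φ : E →L[𝕜] 𝕜} {Δ : E →L[𝕜] E →L[𝕜] 𝕜} {V₀ : E → 𝕜} {Dt D2 : E → E}

/-- **(19), the «last equality»**: the first member `a0 − φ(D̃A) + 2⁻¹Δ(A − D̃A)(A − D̃A) + V₀(A − D̃A)` equals the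
second member `a0 − φ(D̃⁽²⁾A) + 2⁻¹Δ A A + Ṽ₀(A)` with `Ṽ₀` written out — linearity of the `J`-pairing only.
[cite: Balaban1985UV3, (19) p.261] -/
theorem member_two (φ : E →L[𝕜] 𝕜) (Δ : E →L[𝕜] E →L[𝕜] 𝕜) (V₀ : E → 𝕜) (Dt D2 : E → E) (a0 : 𝕜) (A : E) :
    a0 - φ (Dt A) + 2⁻¹ * Δ (A - Dt A) (A - Dt A) + V₀ (A - Dt A) =
      a0 - φ (D2 A) + 2⁻¹ * Δ A A +
        (-(φ (Dt A - D2 A)) + 2⁻¹ * (Δ (A - Dt A) (A - Dt A) - Δ A A) + V₀ (A - Dt A)) := by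
  rw [map_sub φ (Dt A) (D2 A)]
  ring

/-- Near `0`, a higher power of the norm is dominated by a lower one. [folklore] -/
private theorem isBigO_norm_pow_succ (n : ℕ) :
    (fun A : E => ‖A‖ ^ (n + 1)) =O[𝓝 (0 : E)] fun A => ‖A‖ ^ n := by
  refine IsBigO.of_bound 1 ?_
  filter_upwards [ball_mem_nhds (0 : E) one_pos] with A hA
  rw [mem_ball_zero_iff] at hA
  rw [Real.norm_of_nonneg (by positivity), Real.norm_of_nonneg (by positivity), one_mul, pow_succ]
  exact mul_le_of_le_one_right (by positivity) hA.le

/-- The identity map is `O(‖A‖)`. [folklore] -/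
private theorem isBigO_id_norm : (fun A : E => A) =O[𝓝 (0 : E)] fun A => ‖A‖ :=
  isBigO_norm_right.mpr (isBigO_refl _ _)

/-- **«beginning with third order terms»**: if the bond field `D̃` is `O(‖A‖²)`, its quadratic term `D̃⁽²⁾`
approximates it to third order (`D̃ − D̃⁽²⁾ = O(‖A‖³)`), and `V₀ = O(‖Y‖³)`, then the written-out remainder `Ṽ₀` of
(19) is `O(‖A‖³)` at `A = 0`: the `J`-term is `φ` of a third-order quantity, the quadratic form contributes
`−Δ A D̃A − Δ D̃A A + Δ D̃A D̃A = O(‖A‖·‖A‖²)`, and `V₀(A − D̃A) = O(‖A − D̃A‖³) = O(‖A‖³)`.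
[cite: Balaban1985UV3, (19) p.261] -/
theorem remainder_isBigO (hDt2 : Dt =O[𝓝 (0 : E)] fun A => ‖A‖ ^ 2)
    (hD3 : (fun A => Dt A - D2 A) =O[𝓝 (0 : E)] fun A => ‖A‖ ^ 3)
    (hV : V₀ =O[𝓝 (0 : E)] fun Y => ‖Y‖ ^ 3) :
    (fun A => -(φ (Dt A - D2 A)) + 2⁻¹ * (Δ (A - Dt A) (A - Dt A) - Δ A A) + V₀ (A - Dt A))
      =O[𝓝 (0 : E)] fun A => ‖A‖ ^ 3 := by
  -- (a) the J-term
  have ha : (fun A => -(φ (Dt A - D2 A))) =O[𝓝 (0 : E)] fun A => ‖A‖ ^ 3 :=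
    ((φ.isBigO_comp _ _).trans hD3).neg_left
  -- norms of `Dt`
  have hDn : (fun A => ‖Dt A‖) =O[𝓝 (0 : E)] fun A => ‖A‖ ^ 2 := hDt2.norm_left
  have h43 : (fun A : E => ‖A‖ ^ 4) =O[𝓝 (0 : E)] fun A => ‖A‖ ^ 3 := isBigO_norm_pow_succ 3
  -- (b) the three bilinear pieces
  have hb1 : (fun A => Δ A (Dt A)) =O[𝓝 (0 : E)] fun A => ‖A‖ ^ 3 := by
    have h1 : (fun A => Δ A (Dt A)) =O[𝓝 (0 : E)] fun A => ‖A‖ * ‖Dt A‖ :=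
      IsBigO.of_bound ‖Δ‖ (Eventually.of_forall fun A => by
        rw [Real.norm_of_nonneg (by positivity), ← mul_assoc]; exact Δ.le_opNorm₂ A (Dt A))
    have h2 : (fun A => ‖A‖ * ‖Dt A‖) =O[𝓝 (0 : E)] fun A => ‖A‖ * ‖A‖ ^ 2 :=
      (isBigO_refl (fun A : E => ‖A‖) _).mul hDn
    refine (h1.trans h2).trans (isBigO_of_le _ fun A => ?_)
    rw [Real.norm_of_nonneg (by positivity), Real.norm_of_nonneg (by positivity)]
    exact le_of_eq (by ring)
  have hb2 : (fun A => Δ (Dt A) A) =O[𝓝 (0 : E)] fun A => ‖A‖ ^ 3 := by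
    have h1 : (fun A => Δ (Dt A) A) =O[𝓝 (0 : E)] fun A => ‖Dt A‖ * ‖A‖ :=
      IsBigO.of_bound ‖Δ‖ (Eventually.of_forall fun A => by
        rw [Real.norm_of_nonneg (by positivity), ← mul_assoc]; exact Δ.le_opNorm₂ (Dt A) A)
    have h2 : (fun A => ‖Dt A‖ * ‖A‖) =O[𝓝 (0 : E)] fun A => ‖A‖ ^ 2 * ‖A‖ :=
      hDn.mul (isBigO_refl (fun A : E => ‖A‖) _)
    refine (h1.trans h2).trans (isBigO_of_le _ fun A => ?_)
    rw [Real.norm_of_nonneg (by positivity), Real.norm_of_nonneg (by positivity)]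
    exact le_of_eq (by ring)
  have hb3 : (fun A => Δ (Dt A) (Dt A)) =O[𝓝 (0 : E)] fun A => ‖A‖ ^ 3 := by
    have h1 : (fun A => Δ (Dt A) (Dt A)) =O[𝓝 (0 : E)] fun A => ‖Dt A‖ * ‖Dt A‖ :=
      IsBigO.of_bound ‖Δ‖ (Eventually.of_forall fun A => by
        rw [Real.norm_of_nonneg (by positivity), ← mul_assoc]; exact Δ.le_opNorm₂ (Dt A) (Dt A))
    have h2 : (fun A => ‖Dt A‖ * ‖Dt A‖) =O[𝓝 (0 : E)] fun A => ‖A‖ ^ 2 * ‖A‖ ^ 2 := hDn.mul hDn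
    refine ((h1.trans h2).trans (isBigO_of_le _ fun A => ?_)).trans h43
    rw [Real.norm_of_nonneg (by positivity), Real.norm_of_nonneg (by positivity)]
    exact le_of_eq (by ring)
  have hb : (fun A => 2⁻¹ * (Δ (A - Dt A) (A - Dt A) - Δ A A)) =O[𝓝 (0 : E)] fun A => ‖A‖ ^ 3 := by
    have hid : (fun A => Δ (A - Dt A) (A - Dt A) - Δ A A) =
        fun A => -(Δ A (Dt A)) - Δ (Dt A) A + Δ (Dt A) (Dt A) := by
      funext A
      simp only [map_sub, sub_apply]
      ring
    have hbil : (fun A => Δ (A - Dt A) (A - Dt A) - Δ A A) =O[𝓝 (0 : E)] fun A => ‖A‖ ^ 3 := by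
      rw [hid]
      exact (hb1.neg_left.sub hb2).add hb3
    exact hbil.const_mul_left _
  -- (c) the `V₀`-term
  have hg : (fun A => A - Dt A) =O[𝓝 (0 : E)] fun A => ‖A‖ :=
    isBigO_id_norm.sub (hDt2.trans (isBigO_norm_pow_succ 1 |>.trans (by simpa using isBigO_refl _ _)))
  have hg0 : Tendsto (fun A => A - Dt A) (𝓝 (0 : E)) (𝓝 0) := by
    have h0 : Tendsto (fun A : E => ‖A‖) (𝓝 0) (𝓝 0) := by
      simpa using (continuous_norm (E := E)).tendsto 0
    exact hg.trans_tendsto h0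
  have hc : (fun A => V₀ (A - Dt A)) =O[𝓝 (0 : E)] fun A => ‖A‖ ^ 3 :=
    (hV.comp_tendsto hg0).trans (hg.norm_left.pow 3)
  exact (ha.add hb).add hc

/-- **«It is an analytic function of A»**: with `D̃`, `D̃⁽²⁾` analytic at `0`, `D̃(0) = 0` and `V₀` analytic at `0`, the
written-out remainder `Ṽ₀` of (19) is analytic at `0` (bounded linear and bilinear maps of analytic maps, and
`V₀ ∘ (A ↦ A − D̃A)`). [cite: Balaban1985UV3, (19) p.261] -/
theorem remainder_analyticAt (hDa : AnalyticAt 𝕜 Dt 0) (hD2a : AnalyticAt 𝕜 D2 0) (hDt0 : Dt 0 = 0)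
    (hVa : AnalyticAt 𝕜 V₀ 0) :
    AnalyticAt 𝕜 (fun A => -(φ (Dt A - D2 A)) + 2⁻¹ * (Δ (A - Dt A) (A - Dt A) - Δ A A) + V₀ (A - Dt A)) 0 := by
  have hg : AnalyticAt 𝕜 (fun A => A - Dt A) 0 := analyticAt_id.sub hDa
  have hg0 : (fun A => A - Dt A) 0 = 0 := by simp [hDt0]
  have ha : AnalyticAt 𝕜 (fun A => φ (Dt A - D2 A)) 0 := (φ.analyticAt _).comp (hDa.sub hD2a)
  have hb1 : AnalyticAt 𝕜 (fun A => Δ (A - Dt A) (A - Dt A)) 0 := (Δ.analyticAt_bilinear _).comp₂ hg hg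
  have hb2 : AnalyticAt 𝕜 (fun A => Δ A A) 0 := (Δ.analyticAt_bilinear _).comp₂ analyticAt_id analyticAt_id
  have hc : AnalyticAt 𝕜 (fun A => V₀ (A - Dt A)) 0 := hVa.fun_comp_of_eq hg hg0
  exact (ha.neg.add (analyticAt_const.mul (hb1.sub hb2))).add hc

/-! ### The inputs from a power-series expansion of `D̃` beginning at order two -/

variable {p : FormalMultilinearSeries 𝕜 E E}

/-- Partial sums of an expansion whose terms of orders `0` and `1` vanish. [folklore] -/
private theorem partialSum_two_three (hp0 : p 0 = 0) (hp1 : p 1 = 0) (y : E) :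
    p.partialSum 2 y = 0 ∧ p.partialSum 3 y = p 2 fun _ => y := by
  simp only [FormalMultilinearSeries.partialSum, Finset.sum_range_succ, Finset.sum_range_zero, hp0, hp1,
    zero_apply, zero_add]
  exact ⟨trivial, trivial⟩

/-- «Taylor expansion beginning with second order terms» ⇒ `D̃ = O(‖A‖²)`: an expansion `p` of `D̃` at `0` with
`p₀ = p₁ = 0` (Mathlib `HasFPowerSeriesAt.isBigO_sub_partialSum_pow`). [cite: Balaban1985UV3, (17) p.260] -/
theorem isBigO_sq_of_series (hp : HasFPowerSeriesAt Dt p 0) (hp0 : p 0 = 0) (hp1 : p 1 = 0) :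
    Dt =O[𝓝 (0 : E)] fun A => ‖A‖ ^ 2 := by
  have h := hp.isBigO_sub_partialSum_pow 2
  refine h.congr' (Eventually.of_forall fun y => ?_) EventuallyEq.rfl
  beta_reduce
  rw [(partialSum_two_three hp0 hp1 y).1, sub_zero, zero_add]

/-- **`D̃ − D̃⁽²⁾ = O(‖A‖³)`** with `D̃⁽²⁾(A) := p₂(A, A)` the quadratic Taylor term of an expansion `p` of `D̃` at `0`
(`p₀ = p₁ = 0`). [cite: Balaban1985UV3, (19) p.261] -/
theorem isBigO_sub_coeff_two (hp : HasFPowerSeriesAt Dt p 0) (hp0 : p 0 = 0) (hp1 : p 1 = 0) :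
    (fun A => Dt A - p 2 fun _ => A) =O[𝓝 (0 : E)] fun A => ‖A‖ ^ 3 := by
  have h := hp.isBigO_sub_partialSum_pow 3
  refine h.congr' (Eventually.of_forall fun y => ?_) EventuallyEq.rfl
  beta_reduce
  rw [(partialSum_two_three hp0 hp1 y).2, zero_add]

/-- The quadratic term `A ↦ p₂(A, A)` is analytic (a continuous homogeneous polynomial). [cite: Balaban1985UV3, (19) p.261] -/
theorem analyticAt_coeff_two_diag {F : Type*} [NormedAddCommGroup F] [NormedSpace 𝕜 F]
    (p : FormalMultilinearSeries 𝕜 E F) (A₀ : E) :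
    AnalyticAt 𝕜 (fun A : E => p 2 fun _ => A) A₀ := by
  have h1 : AnalyticAt 𝕜 (fun A : E => fun _ : Fin 2 => A) A₀ :=
    (ContinuousLinearMap.pi fun _ : Fin 2 => ContinuousLinearMap.id 𝕜 E).analyticAt A₀
  exact ((p 2).analyticAt).comp h1

/-- **(19), SECOND MEMBER, from an expansion of `D̃` beginning at order two**: for `Dt` analytic at `0` with an
expansion `p`, `p₀ = p₁ = 0` (hence `Dt 0 = 0`), and `V₀` analytic at `0` with `V₀ = O(‖Y‖³)`, the first member of
(19) equals `a0 − φ(D̃⁽²⁾A) + 2⁻¹Δ A A + Ṽ₀(A)` with `D̃⁽²⁾(A) = p₂(A, A)`, and `Ṽ₀` is analytic at `0` and `O(‖A‖³)`.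
[cite: Balaban1985UV3, (19) p.261] -/
theorem member_two_third_order (φ : E →L[𝕜] 𝕜) (Δ : E →L[𝕜] E →L[𝕜] 𝕜) {V₀ : E → 𝕜} {Dt : E → E}
    {p : FormalMultilinearSeries 𝕜 E E} (hp : HasFPowerSeriesAt Dt p 0) (hp0 : p 0 = 0) (hp1 : p 1 = 0)
    (hVa : AnalyticAt 𝕜 V₀ 0) (hV : V₀ =O[𝓝 (0 : E)] fun Y => ‖Y‖ ^ 3) (a0 : 𝕜) :
    (∀ A : E, a0 - φ (Dt A) + 2⁻¹ * Δ (A - Dt A) (A - Dt A) + V₀ (A - Dt A) =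
      a0 - φ (p 2 fun _ => A) + 2⁻¹ * Δ A A +
        (-(φ (Dt A - p 2 fun _ => A)) + 2⁻¹ * (Δ (A - Dt A) (A - Dt A) - Δ A A) + V₀ (A - Dt A))) ∧
    AnalyticAt 𝕜 (fun A => -(φ (Dt A - p 2 fun _ => A)) +
      2⁻¹ * (Δ (A - Dt A) (A - Dt A) - Δ A A) + V₀ (A - Dt A)) 0 ∧
    (fun A => -(φ (Dt A - p 2 fun _ => A)) + 2⁻¹ * (Δ (A - Dt A) (A - Dt A) - Δ A A) + V₀ (A - Dt A))
      =O[𝓝 (0 : E)] fun A => ‖A‖ ^ 3 := by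
  have hDt0 : Dt 0 = 0 := by
    have h := hp.coeff_zero (fun _ => (0 : E))
    rw [hp0, zero_apply] at h
    exact h.symm
  exact ⟨fun A => member_two φ Δ V₀ Dt (fun A => p 2 fun _ => A) a0 A,
    remainder_analyticAt hp.analyticAt (analyticAt_coeff_two_diag p 0) hDt0 hVa,
    remainder_isBigO (isBigO_sq_of_series hp hp0 hp1) (isBigO_sub_coeff_two hp hp0 hp1) hV⟩

end Generic

/-! ## §2  For the local solution of (17): the bond field `hD̃(A)` and its quadratic term `hD̃⁽²⁾(A)` -/

section B10

variable {𝕜 : Type*} [NontriviallyNormedField 𝕜] {β C X : Type*} [Fintype β] [Fintype C]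
  [NormedAddCommGroup X] [NormedSpace 𝕜 X]
  {b₀ : C → β} {h : C → X →ₗ[𝕜] X} {Ct : (β → X) → C → X} {r δ : ℝ} {Dt : (β → X) → C → X}

/-- The bond field `A ↦ hD̃(A) = H (Dt A)` of the local solution has the expansion `H ∘ p` at `0`, whose terms of
orders `0` and `1` vanish («beginning with second order terms»), for every expansion `p` of `Dt` at `0`.
[cite: Balaban1985UV3, (17) p.260] -/
theorem eq17Local_bond_series (h17 : Eq17Local 𝕜 b₀ (fun c => ⇑(h c)) Ct r δ Dt)
    (H : (C → X) →L[𝕜] (β → X)) {p : FormalMultilinearSeries 𝕜 (β → X) (C → X)}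
    (hp : HasFPowerSeriesAt Dt p 0) :
    HasFPowerSeriesAt (fun A => H (Dt A)) (H.compFormalMultilinearSeries p) 0 ∧
      H.compFormalMultilinearSeries p 0 = 0 ∧ H.compFormalMultilinearSeries p 1 = 0 := by
  obtain ⟨ρ, hρ⟩ := hp
  have hp0 : p 0 = 0 := coeff_zero_eq_zero ⟨ρ, hρ⟩ h17.2.2.2.2.1
  have hp1 : p 1 = 0 := coeff_one_eq_zero ⟨ρ, hρ⟩ h17.2.2.2.2.2.fderiv
  refine ⟨⟨ρ, H.comp_hasFPowerSeriesOnBall hρ⟩, ?_, ?_⟩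
  · rw [ContinuousLinearMap.compFormalMultilinearSeries_apply, hp0]; ext v; simp
  · rw [ContinuousLinearMap.compFormalMultilinearSeries_apply, hp1]; ext v; simp

/-- **`hD̃(A) = O(‖A‖²)`** for the bond field of the local solution of (17). [cite: Balaban1985UV3, (17) p.260] -/
theorem eq17Local_bond_isBigO_sq (h17 : Eq17Local 𝕜 b₀ (fun c => ⇑(h c)) Ct r δ Dt)
    (H : (C → X) →L[𝕜] (β → X)) : (fun A => H (Dt A)) =O[𝓝 (0 : β → X)] fun A => ‖A‖ ^ 2 := by
  obtain ⟨p, hp⟩ := eq17Local_analyticAt h17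
  obtain ⟨hHp, h0, h1⟩ := eq17Local_bond_series h17 H hp
  exact isBigO_sq_of_series hHp h0 h1

/-- **`hD̃(A) − hD̃⁽²⁾(A) = O(‖A‖³)`** with `hD̃⁽²⁾(A) = H (p₂(A, A))` for every expansion `p` of the local solution
`Dt` at `0`. [cite: Balaban1985UV3, (19) p.261] -/
theorem eq17Local_bond_sub_coeff_two_isBigO (h17 : Eq17Local 𝕜 b₀ (fun c => ⇑(h c)) Ct r δ Dt)
    (H : (C → X) →L[𝕜] (β → X)) {p : FormalMultilinearSeries 𝕜 (β → X) (C → X)}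
    (hp : HasFPowerSeriesAt Dt p 0) :
    (fun A => H (Dt A) - H (p 2 fun _ => A)) =O[𝓝 (0 : β → X)] fun A => ‖A‖ ^ 3 := by
  obtain ⟨hHp, h0, h1⟩ := eq17Local_bond_series h17 H hp
  have h := isBigO_sub_coeff_two hHp h0 h1
  refine h.congr' (Eventually.of_forall fun A => ?_) EventuallyEq.rfl
  rw [ContinuousLinearMap.compFormalMultilinearSeries_apply]
  rfl

/-- **«Ṽ₀ … beginning with third order terms» for the local solution of (17)**: with `φ = ⟨·, J⟩`, the bounded
bilinear form `Δ = ⟨·, Δ(U₁)·⟩`, `V₀` of third order at `0`, the bond field `A ↦ H (Dt A)` and its quadratic term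
`A ↦ H (p₂(A, A))` (any expansion `p` of `Dt` at `0`), the written-out `Ṽ₀` of (19) is `O(‖A‖³)`.
[cite: Balaban1985UV3, (19) p.261] -/
theorem eq17Local_tildeV0_isBigO (h17 : Eq17Local 𝕜 b₀ (fun c => ⇑(h c)) Ct r δ Dt)
    (H : (C → X) →L[𝕜] (β → X)) {p : FormalMultilinearSeries 𝕜 (β → X) (C → X)}
    (hp : HasFPowerSeriesAt Dt p 0) (φ : (β → X) →L[𝕜] 𝕜) (Δ : (β → X) →L[𝕜] (β → X) →L[𝕜] 𝕜)
    {V₀ : (β → X) → 𝕜} (hV : V₀ =O[𝓝 (0 : β → X)] fun Y => ‖Y‖ ^ 3) :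
    (fun A => -(φ (H (Dt A) - H (p 2 fun _ => A))) +
        2⁻¹ * (Δ (A - H (Dt A)) (A - H (Dt A)) - Δ A A) + V₀ (A - H (Dt A)))
      =O[𝓝 (0 : β → X)] fun A => ‖A‖ ^ 3 :=
  remainder_isBigO (Dt := fun A => H (Dt A)) (D2 := fun A => H (p 2 fun _ => A))
    (eq17Local_bond_isBigO_sq h17 H) (eq17Local_bond_sub_coeff_two_isBigO h17 H hp) hV

/-- **«It is an analytic function of A» for the local solution of (17)**: the written-out `Ṽ₀` of (19) is analytic
at `0` when `V₀` is (the bond field is analytic by (17); its quadratic term is a continuous polynomial).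
[cite: Balaban1985UV3, (19) p.261] -/
theorem eq17Local_tildeV0_analyticAt (h17 : Eq17Local 𝕜 b₀ (fun c => ⇑(h c)) Ct r δ Dt)
    (H : (C → X) →L[𝕜] (β → X)) (p : FormalMultilinearSeries 𝕜 (β → X) (C → X))
    (φ : (β → X) →L[𝕜] 𝕜) (Δ : (β → X) →L[𝕜] (β → X) →L[𝕜] 𝕜) {V₀ : (β → X) → 𝕜} (hVa : AnalyticAt 𝕜 V₀ 0) :
    AnalyticAt 𝕜 (fun A => -(φ (H (Dt A) - H (p 2 fun _ => A))) +
        2⁻¹ * (Δ (A - H (Dt A)) (A - H (Dt A)) - Δ A A) + V₀ (A - H (Dt A))) 0 := by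
  exact remainder_analyticAt (Dt := fun A => H (Dt A)) (D2 := fun A => H (p 2 fun _ => A))
    ((H.analyticAt _).comp (eq17Local_analyticAt h17)) ((H.analyticAt _).comp (analyticAt_coeff_two_diag p 0))
    (by simp [h17.2.2.2.2.1]) hVa

/-- **(19) p. 261, SECOND MEMBER, for the local solution of (17)**: if the function in the exponential satisfies the
FIRST member of (19) on a set `S` of configurations — `f A = a0 − ⟨hD̃(A), J⟩ + ½⟨A − hD̃(A), Δ(U₁)(A − hD̃(A))⟩ +
V₀(A − hD̃(A))` ([7] (26) with the linear term absent, `B10Eq19LinearTerm`) — then on `S`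
`f A = a0 − ⟨hD̃⁽²⁾(A), J⟩ + ½⟨A, Δ(U₁)A⟩ + Ṽ₀(A)` with `hD̃⁽²⁾(A) = H (p₂(A, A))` (every expansion `p` of `Dt` at
`0`), where the written-out `Ṽ₀` «is an analytic function of A with an expansion beginning with third order terms»:
analytic at `0` and `O(‖A‖³)`. [cite: Balaban1985UV3, (19) p.261] -/
theorem eq17Local_eq19_member_two (h17 : Eq17Local 𝕜 b₀ (fun c => ⇑(h c)) Ct r δ Dt)
    (H : (C → X) →L[𝕜] (β → X)) {p : FormalMultilinearSeries 𝕜 (β → X) (C → X)}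
    (hp : HasFPowerSeriesAt Dt p 0) (φ : (β → X) →L[𝕜] 𝕜) (Δ : (β → X) →L[𝕜] (β → X) →L[𝕜] 𝕜)
    {V₀ : (β → X) → 𝕜} (hVa : AnalyticAt 𝕜 V₀ 0) (hV : V₀ =O[𝓝 (0 : β → X)] fun Y => ‖Y‖ ^ 3)
    {S : Set (β → X)} {f : (β → X) → 𝕜} {a0 : 𝕜}
    (h19 : ∀ A ∈ S, f A = a0 - φ (H (Dt A)) + 2⁻¹ * Δ (A - H (Dt A)) (A - H (Dt A)) + V₀ (A - H (Dt A))) :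
    (∀ A ∈ S, f A = a0 - φ (H (p 2 fun _ => A)) + 2⁻¹ * Δ A A +
      (-(φ (H (Dt A) - H (p 2 fun _ => A))) + 2⁻¹ * (Δ (A - H (Dt A)) (A - H (Dt A)) - Δ A A) +
        V₀ (A - H (Dt A)))) ∧
    AnalyticAt 𝕜 (fun A => -(φ (H (Dt A) - H (p 2 fun _ => A))) +
        2⁻¹ * (Δ (A - H (Dt A)) (A - H (Dt A)) - Δ A A) + V₀ (A - H (Dt A))) 0 ∧
    (fun A => -(φ (H (Dt A) - H (p 2 fun _ => A))) +
        2⁻¹ * (Δ (A - H (Dt A)) (A - H (Dt A)) - Δ A A) + V₀ (A - H (Dt A)))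
      =O[𝓝 (0 : β → X)] fun A => ‖A‖ ^ 3 :=
  ⟨fun A hA => by rw [h19 A hA]; exact member_two φ Δ V₀ (fun A => H (Dt A)) (fun A => H (p 2 fun _ => A)) a0 A,
    eq17Local_tildeV0_analyticAt h17 H p φ Δ hVa, eq17Local_tildeV0_isBigO h17 H hp φ Δ hV⟩

/-! ### With `D̃⁽²⁾ = hC⁽²⁾` (p. 260, `B10Eq17RecursiveSystem`): the `J`-term of the second member in terms of `C` -/

/-- **The `J`-term of (19)'s second member with print's identification `QD̃⁽²⁾(A, c) = C⁽²⁾(A, c)`** (p. 260; our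
`B10Eq17RecursiveSystem.eq17Local_coeff_two_diag`): for EVERY expansion `p` of the local solution `Dt` and `q` of
`C̃` at `0`, `⟨hD̃⁽²⁾(A), J⟩ = ⟨hC⁽²⁾(A), J⟩`, i.e. `φ (H (p₂(A, A))) = φ (H (q₂(A, A)))` — the form in which the
quadratic term enters later steps ([Balaban1987RG1] (2.11): «⟨H₁hC̃⁽²⁾(B′), J⟩»); `H` the support operator
(`H D = hOpLin b₀ h D`), complete `X`, `char 𝕜 = 0`. [cite: Balaban1985UV3, (19) p.261] -/
theorem eq17Local_Jterm_eq_hC2 [CompleteSpace X] [CharZero 𝕜] (h17 : Eq17Local 𝕜 b₀ (fun c => ⇑(h c)) Ct r δ Dt)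
    (H : (C → X) →L[𝕜] (β → X)) (hH : ∀ D, H D = hOpLin b₀ h D)
    {p q : FormalMultilinearSeries 𝕜 (β → X) (C → X)} (hp : HasFPowerSeriesAt Dt p 0)
    (hq : HasFPowerSeriesAt Ct q 0) (φ : (β → X) →L[𝕜] 𝕜) (A : β → X) :
    φ (H (p 2 fun _ => A)) = φ (H (q 2 fun _ => A)) := by
  rw [eq17Local_coeff_two_diag h17 H hH hp hq A]

/-- **(19) p. 261, SECOND MEMBER WITH `hC⁽²⁾`**: under the hypotheses of `eq17Local_eq19_member_two` and for every
expansion `q` of `C̃` at `0`, on `S`: `f A = a0 − ⟨hC⁽²⁾(A), J⟩ + ½⟨A, Δ(U₁)A⟩ + Ṽ₀(A)` (the remainder `Ṽ₀` written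
out with `hD̃⁽²⁾(A) = H (p₂(A, A))`, analytic at `0` and `O(‖A‖³)` by `eq17Local_eq19_member_two`).
[cite: Balaban1985UV3, (19) p.261] -/
theorem eq17Local_eq19_member_two_hC2 [CompleteSpace X] [CharZero 𝕜]
    (h17 : Eq17Local 𝕜 b₀ (fun c => ⇑(h c)) Ct r δ Dt)
    (H : (C → X) →L[𝕜] (β → X)) (hH : ∀ D, H D = hOpLin b₀ h D)
    {p q : FormalMultilinearSeries 𝕜 (β → X) (C → X)} (hp : HasFPowerSeriesAt Dt p 0)
    (hq : HasFPowerSeriesAt Ct q 0) (φ : (β → X) →L[𝕜] 𝕜) (Δ : (β → X) →L[𝕜] (β → X) →L[𝕜] 𝕜)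
    (V₀ : (β → X) → 𝕜) {S : Set (β → X)} {f : (β → X) → 𝕜} {a0 : 𝕜}
    (h19 : ∀ A ∈ S, f A = a0 - φ (H (Dt A)) + 2⁻¹ * Δ (A - H (Dt A)) (A - H (Dt A)) + V₀ (A - H (Dt A))) :
    ∀ A ∈ S, f A = a0 - φ (H (q 2 fun _ => A)) + 2⁻¹ * Δ A A +
      (-(φ (H (Dt A) - H (p 2 fun _ => A))) + 2⁻¹ * (Δ (A - H (Dt A)) (A - H (Dt A)) - Δ A A) +
        V₀ (A - H (Dt A))) := by
  intro A hA
  rw [h19 A hA, ← eq17Local_Jterm_eq_hC2 h17 H hH hp hq φ A]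
  exact member_two φ Δ V₀ (fun A => H (Dt A)) (fun A => H (p 2 fun _ => A)) a0 A

end B10

end Literature.MathematicalPhysics.QuantumFieldTheory.Balaban1983to89.B10Eq19ThirdOrder
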